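import Summits.HodgeConjecture.CorCM.OcticWeilOrbitWeilParts
import HarnessLib

/-!
# COR-CM — the Hodge conjecture for EVERY PRODUCT OF COPIES of `E, B₁, B₂, B₃` — the CM curve of `k` and the three
# `(2,2)`-types `Φ_{I_m}` of ONE octic CM field `F ⊇ k` (all Galois conjugates of a degenerate simple CM fourfold) — GIVEN
# ONLY Markman's fourfold theorem: the FRAME FORM

Cell `pub-hodgecm2` (COR-CM), seat b30 gen 20 (2026-08-22); count-neutral own lane OCTIC-WEIL-ORBIT — assembly.  Theorems
only; no definition, no `sorry`; the ONE named fact is DISPLAYED as a hypothesis: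
`Markman2025_weilClasses_algebraic_abelianFourfold` (E. Markman 2025, unrefereed: on an abelian FOURFOLD of Weil type every
rational class of `W_k ⊗ ℂ ⊕ W̄` is algebraic).  The INTRINSIC / GEOMETRIC forms (no frame; `2`-transitivity, resp. the
simplicity of one `B_m`, in place of `hgal`) follow in `CorCM/OcticWeilOrbitRealisers.lean` and
`CorCM/OcticWeilOrbitHodgeOfMarkman.lean`.

THE ARGUMENT (kernel, this lineage).  For `X = ⨁_j A₄(κ j)` — ANY product of copies of `E = A₄ 0 ⊨ (k; {τ})` and
`B_m = A₄ (m+1) ⊨ (F; Φ_{I_m})`, in any order (`κ : Fin N → Fin 4`) — a rational `(p,p)`-class lies in the span of the weight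
LINES `weightClassesAlg _ _ (2p) S` over Pohlmann's `Aut(ℂ)`-balanced weights `S` of the CM algebra `∏_j K_{κ j}`
(`Pohlmann1968_thm1_cmAlgebra`, the tree's Thm 1 for CM algebras).  By FRAME TRANSFER
(`modelBalanced₃_of_isGaloisBalancedAlg`: the twelve even permutations of the conjugate pairs are realised in `Aut(ℂ)`,
`hgal`) such an `S` is a balanced configuration of the 26-point model, hence (kernel census `Census/OcticWeilOrbit(Parts)`:
the DEFECT LAW `e = 0`, `d_{m,a} = d_{m,0}` and the induction principle `modelBalanced₃_induction`) a disjoint union of PAIR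
PARTS (divisor lines, `weightClassesAlg_le_algebraicClasses_of_isPairPart₃`) and WEIL PARTS of the three types (lifted Weil
lines `⋀⁴ H¹(B_m)_{τ_b}`, algebraic by Markman's theorem on the fourfold `B_m` and seat b30's distribution lemma,
`weightClassesAlg_le_algebraicClasses_of_isWeil₃Part`); lines of disjoint unions multiply
(`PairWeights.weightClassesAlg_union_le_algebraicClasses`).  NO class mixes two conjugates `B_m, B_{m'}`: the cross factors
and the curve enter through divisors only.
HONEST FRAMING: conditional on the displayed Markman binder; nothing here asserts `HC_CM`.

## References
* [Pohlmann1968] H. Pohlmann, Ann. of Math. 88 (1968), Thm 1.  [GaoUllmo2025] Z. Gao, E. Ullmo, J. Inst. Math. Jussieu 25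
  (2025), Thm 3.1.  [Milne2020HodgeClassesAV] J. S. Milne, arXiv:2010.08857, 1.2 (a), Thm. 1.  [Markman2025SurveySecant]
  E. Markman, arXiv:2509.23403, Thm. 1.2 and §1.1.  [MoonenZarhin1995Duke] B. Moonen, Yu. Zarhin, Duke Math. J. 77
  (1995), Thm. 2.4.  [Dodson1984] B. Dodson, Trans. AMS 283 (1984), §3.3.2 Theorem.  [MumfordAV1970] D. Mumford,
  *Abelian Varieties*, §19.
-/

noncomputable section

open CategoryTheory CategoryTheory.Limits NumberField

namespace Summit.HodgeConjecture.CorCM.OcticWeilOrbit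

open Literature.AlgebraicGeometry Literature.AlgebraicGeometry.Motives Literature.AlgebraicGeometry.HodgeTheory
open Literature.AlgebraicGeometry.ComplexMultiplication (IsCMTypeRealisation)
open Literature.AlgebraicGeometry.Pohlmann1968
open Literature.AlgebraicTopology.SingularHomology
open Literature.NumberTheory.ComplexMultiplication
open Summit.HodgeConjecture.CorCM.Census.OcticWeilOrbit (Pt₃ permTab signTab ModelBalanced₃ IsPairPart₃ IsWeil₃Part
  modelBalanced₃_induction)
open Summit.HodgeConjecture.CorCM.PairWeights

open scoped Classical Pointwise

section Assembly

variable {I : Type} {Kf : I → Type} [∀ i, Field (Kf i)] [∀ i, NumberField (Kf i)] [∀ i, IsCMField (Kf i)]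
  {i₀ i₁ : I} {N : ℕ} {τ : Kf i₀ →+* ℂ}
  {A₄ : Fin 4 → AbelianVariety ℂ} {Φ₄ : ∀ j : Fin 4, CMType (Kf (orbitSlots i₀ i₁ j))}
  {ι₄ : ∀ j, 𝓞 (Kf (orbitSlots i₀ i₁ j)) →+* End (A₄ j)}
  {θ₄ : ∀ j, Kf (orbitSlots i₀ i₁ j) →+* Module.End ℂ (complexBetti (A₄ j).X 1)}

/-- **MAIN THEOREM (frame form).  The Hodge conjecture for every product of copies `⨁_j A₄(κ j)` of `E, B₁, B₂, B₃` — i.e.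
for `E^a × B₁^{n₁} × B₂^{n₂} × B₃^{n₃}`, all exponents, any order — GIVEN ONLY Markman's fourfold theorem**, for `E ⊨ (k; {τ})`
and `B_m ⊨ (F; Φ_{I_m})` (`m < 3`) the three pairwise non-conjugate CM types of `k`-signature `(2,2)` of an octic CM field
`F ⊇ i(k)`, read in a frame `e` (`Φ_{I_m} = {s | (e s).2 = [(e s).1 ∈ {0, m+1}]}`), whose conjugate pairs admit every EVEN
permutation under `Aut(ℂ)` (`hgal`; Dodson: automatic when one `B_m` is simple): every rational `(p,p)`-class on `⨁_j A₄ (κ j)`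
is algebraic, for every slot map `κ : Fin N → Fin 4`.  Leaves: `Markman2025_weilClasses_algebraic_abelianFourfold` ONLY.
[cite: Markman2025SurveySecant, Thm. 1.2] [cite: Pohlmann1968, Thm 1] [cite: GaoUllmo2025, Thm 3.1]
[cite: Milne2020HodgeClassesAV, 1.2 (a) and Thm. 1] [cite: Dodson1984, §3.3.2 Theorem] -/
theorem hodgeConjectureFor_biproduct_comp_of_frame₃_of_markman
    (hW4 : Markman2025_weilClasses_algebraic_abelianFourfold) (κ : Fin N → Fin 4)
    (h8 : Module.finrank ℚ (Kf i₁) = 8) (h2 : Module.finrank ℚ (Kf i₀) = 2) (i : Kf i₀ →+* Kf i₁)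
    (hA : ∀ j, IsCMTypeRealisation (Φ₄ j) (A₄ j) (ι₄ j) (θ₄ j))
    (e : (Kf i₁ →+* ℂ) ≃ Fin 4 × Bool)
    (he_sign : ∀ s : Kf i₁ →+* ℂ, (e s).2 = true ↔ s.comp i = τ)
    (he_conj : ∀ s : Kf i₁ →+* ℂ, e (ComplexEmbedding.conjugate s) = ((e s).1, !(e s).2))
    (hΦ : ∀ (m : Fin 3) (s : Kf i₁ →+* ℂ), s ∈ (Φ₄ m.succ).1 ↔ (e s).2 = signTab 0 m (e s).1)
    (hΨ : ∀ σ : Kf i₀ →+* ℂ, σ ∈ (Φ₄ 0).1 ↔ σ = τ)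
    (hgal : ∀ r : Fin 12, ∃ ρ : ℂ ≃+* ℂ,
      ∀ a : Fin 4, (ρ : ℂ →+* ℂ).comp (e.symm (a, true)) = e.symm (permTab r a, true)) :
    HodgeConjectureFor (⨁ fun j => A₄ (κ j)).dim (⨁ fun j => A₄ (κ j)).X := by
  have hττ : ComplexEmbedding.conjugate τ ≠ τ := QuarticCM.conjugate_ne τ
  have hk : ∀ σ : Kf i₀ →+* ℂ, σ = τ ∨ σ = ComplexEmbedding.conjugate τ := fun σ =>
    QuarticCM.eq_or_eq_conjugate_of_quadratic h2 τ σ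
  have hcount : ∀ (m : Fin 3) (τ' : Kf i₀ →+* ℂ),
      (Finset.univ.filter fun s : Kf i₁ →+* ℂ => s.comp i = τ' ∧ s ∈ (Φ₄ m.succ).1).card = 2 :=
    fun m => typeCount_eq_two_of_frame₃ h2 he_sign m (hΦ m)
  refine ⟨nonempty_hodgeModel_holds (Motives.AbelianVariety.isSmoothProjective_holds (A := ⨁ fun j => A₄ (κ j))),
    fun p c hc hH => ?_⟩
  have hAκ : ∀ j, IsCMTypeRealisation (Φ₄ (κ j)) (A₄ (κ j)) (ι₄ (κ j)) (θ₄ (κ j)) := fun j => hA (κ j)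
  -- every balanced configuration has algebraic weight lines: induct over its generating parts
  have key : ∀ (R : Finset ((j : Fin N) × (Kf (orbitSlots i₀ i₁ (κ j)) →+* ℂ))),
      ModelBalanced₃ (fun x => toPt₃ e τ ((Sigma.map κ (fun _ => id) :
        ((j : Fin N) × (Kf (orbitSlots i₀ i₁ (κ j)) →+* ℂ)) → ((m : Fin 4) × (Kf (orbitSlots i₀ i₁ m) →+* ℂ))) x)) R →
      ∀ q, R.card = 2 * q → weightClassesAlg (fun j => A₄ (κ j)) (fun j => ι₄ (κ j)) (2 * q) R ≤
        algebraicClasses (⨁ fun j => A₄ (κ j)).X q := by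
    intro R hR
    refine modelBalanced₃_induction (motive := fun R => ∀ q, R.card = 2 * q →
      weightClassesAlg (fun j => A₄ (κ j)) (fun j => ι₄ (κ j)) (2 * q) R ≤ algebraicClasses (⨁ fun j => A₄ (κ j)).X q)
      (fun q hq => ?_) (fun G R hGR hG ih q hq => ?_) (fun G R m b hGR hG ih q hq => ?_) hR
    · obtain rfl : q = 0 := by simpa using hq.symm
      exact fun c _ => hodgeConjectureFor_codim_zero c
    · -- a pair part: a divisor line
      obtain ⟨ha, hGalg⟩ := weightClassesAlg_le_algebraicClasses_of_isPairPart₃ κ hττ hk he_conj hA hG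
      have hRcard : R.card = 2 * (q - 1) := by
        have h := Finset.card_union_of_disjoint hGR
        rw [hq, ha] at h
        omega
      have haq : 1 + (q - 1) = q := by
        have h := Finset.card_union_of_disjoint hGR
        rw [hq, ha] at h
        omega
      rw [← Finset.disjUnion_eq_union G R hGR]
      exact weightClassesAlg_union_le_algebraicClasses hAκ haq ha hRcard hGR hGalg (ih (q - 1) hRcard)
    · -- a Weil part of type `m`: a lifted Weil line of `B_m`, algebraic by Markman's theorem
      obtain ⟨ha, hGalg⟩ :=
        weightClassesAlg_le_algebraicClasses_of_isWeil₃Part κ hW4 h8 h2 hττ hk he_sign hA hcount hG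
      have hRcard : R.card = 2 * (q - 2) := by
        have h := Finset.card_union_of_disjoint hGR
        rw [hq, ha] at h
        omega
      have haq : 2 + (q - 2) = q := by
        have h := Finset.card_union_of_disjoint hGR
        rw [hq, ha] at h
        omega
      rw [← Finset.disjUnion_eq_union G R hGR]
      exact weightClassesAlg_union_le_algebraicClasses hAκ haq ha hRcard hGR hGalg (ih (q - 2) hRcard)
  have hmem : c ∈ ⨆ S ∈ pohlmannSetsAlg (K := fun j => Kf (orbitSlots i₀ i₁ (κ j))) (fun j => Φ₄ (κ j)) p,
      weightClassesAlg (fun j => A₄ (κ j)) (fun j => ι₄ (κ j)) (2 * p) S := by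
    rw [← (Pohlmann1968_thm1_cmAlgebra (fun j => Kf (orbitSlots i₀ i₁ (κ j))) (fun j => A₄ (κ j))
      (fun j => Φ₄ (κ j)) (fun j => ι₄ (κ j)) (fun j => θ₄ (κ j)) hAκ p).1]
    exact Submodule.subset_span ⟨hc, hH⟩
  have hle : (⨆ S ∈ pohlmannSetsAlg (K := fun j => Kf (orbitSlots i₀ i₁ (κ j))) (fun j => Φ₄ (κ j)) p,
      weightClassesAlg (fun j => A₄ (κ j)) (fun j => ι₄ (κ j)) (2 * p) S) ≤
      algebraicClasses (⨁ fun j => A₄ (κ j)).X p := by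
    refine iSup₂_le fun S hS => ?_
    exact key S (modelBalanced₃_of_isGaloisBalancedAlg hττ hk he_sign he_conj hΦ hΨ κ hgal hS.2) p hS.1
  exact hle hmem

/-- **The Hodge conjecture for every abelian variety dominated by a product of copies `⨁_j A₄(κ j)`** (frame form,
modulo Markman's fourfold theorem): everything isogenous to a product of copies of `E, B₁, B₂, B₃` and their abelian
subvarieties and quotients. [cite: Markman2025SurveySecant, Thm. 1.2] [cite: MumfordAV1970, §19] -/
theorem hodgeConjectureFor_of_avDominatedBy_comp_of_frame₃_of_markman
    (hW4 : Markman2025_weilClasses_algebraic_abelianFourfold) (κ : Fin N → Fin 4)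
    (h8 : Module.finrank ℚ (Kf i₁) = 8) (h2 : Module.finrank ℚ (Kf i₀) = 2) (i : Kf i₀ →+* Kf i₁)
    (hA : ∀ j, IsCMTypeRealisation (Φ₄ j) (A₄ j) (ι₄ j) (θ₄ j))
    (e : (Kf i₁ →+* ℂ) ≃ Fin 4 × Bool)
    (he_sign : ∀ s : Kf i₁ →+* ℂ, (e s).2 = true ↔ s.comp i = τ)
    (he_conj : ∀ s : Kf i₁ →+* ℂ, e (ComplexEmbedding.conjugate s) = ((e s).1, !(e s).2))
    (hΦ : ∀ (m : Fin 3) (s : Kf i₁ →+* ℂ), s ∈ (Φ₄ m.succ).1 ↔ (e s).2 = signTab 0 m (e s).1)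
    (hΨ : ∀ σ : Kf i₀ →+* ℂ, σ ∈ (Φ₄ 0).1 ↔ σ = τ)
    (hgal : ∀ r : Fin 12, ∃ ρ : ℂ ≃+* ℂ,
      ∀ a : Fin 4, (ρ : ℂ →+* ℂ).comp (e.symm (a, true)) = e.symm (permTab r a, true))
    {C : AbelianVariety ℂ} (hC : Domination.AVDominatedBy C (⨁ fun j => A₄ (κ j))) :
    HodgeConjectureFor C.dim C.X :=
  Domination.hodgeConjectureFor_of_avDominatedBy
    (hodgeConjectureFor_biproduct_comp_of_frame₃_of_markman hW4 κ h8 h2 i hA e he_sign he_conj hΦ hΨ hgal) hC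

end Assembly

end Summit.HodgeConjecture.CorCM.OcticWeilOrbit

end
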